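import Mathlib
import Summits.ValiantsHypothesis.ValiantsHypothesis.Theses.PrincipalMinorColouring
import Literature.Computability.AlgebraicComplexity.ReadKDeterminantalRepresentationsProofs
import Summits.ValiantsHypothesis.ValiantsHypothesis.Theorems.PrincipalMinorColouringBorderBoundedRankTwoTransport
import Summits.ValiantsHypothesis.ValiantsHypothesis.Theorems.PrincipalMinorColouringBorderBoundedRankTwoStubDenseCount

/-!
# Route PrincipalMinorColouring — crux `BorderBoundedRankTwo` (stmt-ValiantsHypothesis-21038) PROVED:
# border rank-two impossibility for principal-minor expressions of the permanent

`BorderBoundedRankTwo` (T6 rung `r = 2` of `BorderBoundedRank`, stmt-3778): there is `n₀` such that for all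
`n ≥ n₀`, every `R` and every colouring `κ : Fin R → Fin n × Fin n` of the `R` slots with colour classes of size
`≤ 2`, the coefficient function of `per_n(x+J)` is NOT in the closure (product topology on coefficient functions)
of the coefficient functions of `n! · det (I_R + diag(x ∘ κ) K)`, `K ∈ ℂ^{R×R}` — the permanent is not even a
LIMIT of rank-two principal-minor expressions.

This file is the composition `BorderBoundedRankTwo_of` of the registered line
`Cruxes/BorderBoundedRankTwo/Lines/closure_counting.lean` (val-width-lines-2), VERBATIM, over its two stubs, both
landed by name and signature in `namespace …Theorems.BorderBoundedRankTwoClosureCounting`: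
* `stub_transport` (`…PrincipalMinorColouringBorderBoundedRankTwoTransport.lean`, val-width-21038-p1): border
  membership ⇒ for every injective placement `ζ` of `k` variables and every substitution of constants outside
  `ζ`, the `2^k` coefficients of the substituted permanent lie in `closure (NFImage k)` (images of Hrubeš–Joglekar's
  `2s × 2s` normal-form coefficient maps, `s ≤ 2k`);
* `stub_denseCount` (`…PrincipalMinorColouringBorderBoundedRankTwoStubDenseCount.lean`, val-width-21038-p2): if
  `closure (NFImage k)` is everything then `2^k ≤ 1 + (4k)^2`;
and the tree's universality of the permanent for well-placed variables (`exists_subst_perPoly_eq`, Hrubeš–Joglekar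
2025 Thm. 3 / Thm. 7 via the read-once permanent tree gadget, `n ≥ |V k|`): with `k = 11` (`2^11 = 2048 > 1937`)
and `n₀ = |V 11| + 11` every vector would be such a limit — contradiction.

Calibration (honest): a corollary of Hrubeš–Joglekar 2025 (Lemma 1, Thm. 2, Thm. 7 — all proved in the tree) and
elementary topology ("images pass to closures"); it is NOT an open problem and NOT ≥ any open bound.  VP ≠ VNP is
not moved: the route's open content (`TotalRankNotQP`, quasi-polynomial total rank) is untouched.

## References
* P. Hrubeš, P. S. Joglekar, *On read-k projections of the determinant*, STACS 2025, LIPIcs 327, Art. 53,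
  Lemma 1, Thms. 2, 3, 7, Cor. 8 (pp. 53:3–53:6). [HrubesJoglekar2025]
-/

noncomputable section

-- `Summit.ValiantsHypothesis.ValiantsHypothesis.…` is the tree's single-conjunct layout (Sub = Summit).
set_option linter.dupNamespace false

namespace Summit.ValiantsHypothesis.ValiantsHypothesis.Theorems.BorderBoundedRankTwoClosureCounting

open MvPolynomial Matrix
open Literature.Computability.AlgebraicComplexity
open Summit.ValiantsHypothesis.ValiantsHypothesis.Theses.PrincipalMinorColouring

/-- **`BorderBoundedRankTwo` (stmt-ValiantsHypothesis-21038) holds**: for `n ≥ |V 11| + 11` and every colouring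
`κ` of the slots with classes of size `≤ 2`, the coefficient function of `per_n(x+J)` is not in the closure of the
coefficient functions of the rank-two principal-minor expressions `n! · det (I_R + diag(x ∘ κ) K)`.  The line's
composition `BorderBoundedRankTwo_of` verbatim: `k = 11`, diagonal placement `ζ i = (i, i)`, universality
`exists_subst_perPoly_eq` (`ringChar ℂ = 0 ≠ 2`), `stub_transport`, `stub_denseCount`, `norm_num`
(`2048 ≤ 1937` is false). [cite: HrubesJoglekar2025, Cor. 8 (p. 53:6)] -/
theorem borderBoundedRankTwo_proof : BorderBoundedRankTwo := by
  refine ⟨Fintype.card (ReadOnceTree.V 11) + 11, fun n hn R κ hκ hv => ?_⟩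
  have hVn : Fintype.card (ReadOnceTree.V 11) ≤ n := by omega
  have h11 : 11 ≤ n := by omega
  set ζ : Fin 11 → Fin n × Fin n := fun i => (Fin.castLE h11 i, Fin.castLE h11 i) with hζ
  have hr : Function.Injective fun i => (ζ i).1 := fun i j h => Fin.castLE_injective h11 (by simpa [hζ] using h)
  have hc : Function.Injective fun i => (ζ i).2 := fun i j h => Fin.castLE_injective h11 (by simpa [hζ] using h)
  have hζinj : Function.Injective ζ := fun i j h => hr (congrArg Prod.fst h)
  have hF : ringChar ℂ ≠ 2 := by rw [ringChar.eq_zero]; norm_num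
  have hall : ∀ c : (Fin 11 → Bool) → ℂ, c ∈ closure (NFImage 11) := by
    intro c
    obtain ⟨S, hS1, hS2, hS3⟩ := exists_subst_perPoly_eq hF hVn ζ hr hc c
    exact stub_transport n R κ hκ hv 11 ζ hζinj S c hS1 hS2 hS3
  have h := stub_denseCount 11 hall
  norm_num at h

end Summit.ValiantsHypothesis.ValiantsHypothesis.Theorems.BorderBoundedRankTwoClosureCounting
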